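import Summits.QuantumFields.YangMills.Theorems.BalabanUVNodesPortS1LZdetTwinLift
import Summits.QuantumFields.YangMills.Theorems.BalabanUVNodesPortS1LZdetTwinLocal
import Summits.QuantumFields.YangMills.Theorems.BalabanUVNodesPortS1LZdetTwinGeomK
import Summits.QuantumFields.YangMills.Theorems.BalabanUVNodesPortS1LocPowTransport

/-!
# NODE O port PT-A — THE COVER BRIDGE OF THE INTEGER POWER MEMBER and ★★★ `powMemberIntTwin_holds : PowMemberIntTwin F` (`stub_LZdetTwin` of 27930, line `pta_residueW`):
# off the centred wrap class, `powTwin … (X̂_K(X)) (φ ∘ π) = powMemberPiece (Y ↦ Y) (Y ↦ nonB0Block (TY Y φ)) R X`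

Cell `ym-nodeO-ideate`, porter seat `ymgap-nodeO-port-PTA-1` (gen 8); `--supports stmt-QuantumFields-27930` (helper, P0-free).  [I] = [Balaban1987RG1], [16] = [Balaban1985UV3].
* §1 the centred lift: `blockMap_twinLiftSite` (`⌊lift∕(L·Mc)⌋ = valMinAbs □`), `coverAt_twinLiftSite` (`π_k ∘ lift = id`), `coverBondAt_twinLiftBond`, `twinLiftBond_mem_twinBonds` (non-central stays
  non-central, ✓`coverBondAt_mem_range_centralBond_of_isCentralZ`), `exists_twinLift_preimage` (every non-central integer bond of `X̂_K(X)` is a lift, ✓`isCentralZ_of_coverBondAt_mem_range` +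
  window injectivity), `not_mem_recordWrapCtr_of_subset`.
* §2 ★★★ `powTwin_intCubes_pullPair` — the bridge: two applications of ✓`powMemberPiece_transport` (torus pieces∕indices restricted to `X`; then the lift `Y ↦ X̂_K(Y)`, `(b, a) ↦ (b̂, a)`), entries by
  (Z-bridge) on the cubes of `Y` and by (P4-supp)∕(Z-supp) off them, extra integer cube sets killed by (Z-dom) (✓`twinMat_eq_zero_of_not_lift`).
* §3 ★★★ `powMemberIntTwin_holds (F : T4Family) : PowMemberIntTwin F` — witness ✓`powTwinLocal` ((Z-loc), (Z-cov)) + §2 at every volume `recordK₀ + n`.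

HONEST FRAMING.  Torus ∕ integer bookkeeping over DISPLAYED clauses of the P0-ℂ body (inhabited nowhere); NOTHING of Bałaban's estimates asserted, ported or discharged; with this file the registered
stub `stub_LZdetTwin` closes (by-name file `…PortRecordRepresentationS1StubLZdetTwin`) and the Gaussian bracket's glue `stub_LZdetGlue` is a theorem outright; `stub_P0C` ∕ `stub_G3C` ∕ `stub_FE`
OPEN; 27930 OPEN · no claim; NODE O 0∕1; COUNT 8∕28 · K 1∕4 UNMOVED; finite `𝕋⁴_{L^K}` at fixed ε — NOT continuum ∕ OS ∕ Clay; **the Yang–Mills mass gap is NOT proved by any of this.**  No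
`sorry`, no `def`, no `instance`, no `notation`; standard axioms.
-/

noncomputable section

open scoped BigOperators Matrix.Norms.L2Operator
open Finset

namespace Summit.QuantumFields.YangMills.Theorems.BalabanUVNodesPortS1

open Summit.QuantumFields.YangMills.Theorems.K0RecordFormatNames
open Literature.MathematicalPhysics.QuantumFieldTheory.Balaban1983to89
open Literature.MathematicalPhysics.QuantumFieldTheory.Balaban1983to89.Node00
open Literature.MathematicalPhysics.QuantumFieldTheory.Balaban1983to89.T4Continuum (T4Family)
open Literature.MathematicalPhysics.QuantumFieldTheory.Balaban1983to89.TreeLengthTorus (TPt IsTDom proj)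
open Literature.MathematicalPhysics.QuantumFieldTheory.Balaban1983to89.BlockAveragingHaarAC (centralBond)
open Literature.MathematicalPhysics.QuantumLattice (blockMap blockSites mem_blockSites_iff)

variable {F : T4Family}

/-! ## §1  The centred lift -/

/-- The `Mc`-cube label of a level-`k` site is `⌊x ∕ (L·Mc)⌋` read modulo `q` (tiled range). [cite: Balaban1987RG1, p.257 (bookkeeping)] -/
theorem cubeOfSite_blockOf_apply {Mc k K : ℕ} (hK : recordK₀ F Mc k ≤ K) (x : Site (F.P K) k) (i : Fin (F.P K).d) :
    cubeOfSite F Mc k K (blockOf x) i = (((x i).val / (F.L * Mc) : ℕ) : ZMod (Sect2.domCount (F.P K) Mc (k + 1))) := by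
  show ((((blockOf x) i).val / Mc : ℕ) : ZMod (Sect2.domCount (F.P K) Mc (k + 1))) = _
  rw [Site.val_blockOf (succ_le_m_add_K_of_recordK₀_le hK), Nat.div_div_eq_div_mul, F.P_L]

/-- **`⌊lift(x) ∕ (L·Mc)⌋ = valMinAbs □(x)`**. [cite: Balaban1987RG1, (1.21) p.264 (bookkeeping)] -/
theorem blockMap_twinLiftSite {Mc k K : ℕ} (hMc : McGuard F Mc) (x : Site (F.P K) k) :
    blockMap (F.L * Mc) (twinLiftSite F Mc k K x) = fun i => ((cubeOfSite F Mc k K (blockOf x) i).valMinAbs : ℤ) := by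
  have hMc0 : 0 < Mc := PortHRecordRowG.mc_pos hMc
  have hLM : 0 < F.L * Mc := Nat.mul_pos (by have := F.hL.2; omega) hMc0
  have hLMz : ((F.L * Mc : ℕ) : ℤ) ≠ 0 := by exact_mod_cast hLM.ne'
  funext i
  show (((F.L * Mc : ℕ) : ℤ) * ((cubeOfSite F Mc k K (blockOf x) i).valMinAbs : ℤ) + (((x i).val % (F.L * Mc) : ℕ) : ℤ)) / ((F.L * Mc : ℕ) : ℤ) = _
  rw [add_comm, Int.add_mul_ediv_left _ _ hLMz, Int.ediv_eq_zero_of_lt (by positivity) (by exact_mod_cast Nat.mod_lt _ hLM), zero_add]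

/-- **`π_k (lift x) = x`** (the lift keeps the remainders of `x` modulo `L·Mc`, and `valMinAbs □(x) ≡ ⌊x∕(L·Mc)⌋ (mod q)` with `q·L·Mc = N_k`). [cite: Balaban1987RG1, (1.21) p.264 (bookkeeping)] -/
theorem coverAt_twinLiftSite {Mc k K : ℕ} (hMc : McGuard F Mc) (hK : recordK₀ F Mc k ≤ K) (x : Site (F.P K) k) : coverAt (F.P K) k (twinLiftSite F Mc k K x) = x := by
  have hk : k + 1 ≤ (F.P K).m + (F.P K).K := succ_le_m_add_K_of_recordK₀_le hK
  have hN : (((F.P K).sitesPerDir k : ℕ) : ℤ) = (Sect2.domCount (F.P K) Mc (k + 1) : ℤ) * ((F.L * Mc : ℕ) : ℤ) := by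
    rw [(F.P K).sitesPerDir_eq_mul_succ hk, PortHRecordRowG.sitesPerDir_eq_domCount_mul hMc hK, F.P_L]; push_cast; ring
  funext i
  rw [coverAt_apply]
  set a := cubeOfSite F Mc k K (blockOf x) i with ha
  have h1 : ((a.valMinAbs : ℤ) : ZMod (Sect2.domCount (F.P K) Mc (k + 1))) = (((a.val : ℕ) : ℤ) : ZMod (Sect2.domCount (F.P K) Mc (k + 1))) := by
    rw [ZMod.coe_valMinAbs, Int.cast_natCast, ZMod.natCast_zmod_val]
  obtain ⟨t, ht⟩ := (ZMod.intCast_eq_intCast_iff_dvd_sub _ _ _).1 h1.symm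
  have hval : a.val = (x i).val / (F.L * Mc) := by
    rw [ha, cubeOfSite_blockOf_apply hK, ZMod.val_natCast, Nat.mod_eq_of_lt (val_div_mul_lt_domCount hMc hK x i)]
  have hdm := Nat.div_add_mod (x i).val (F.L * Mc)
  have hy : twinLiftSite F Mc k K x i = ((x i).val : ℤ) + (((F.P K).sitesPerDir k : ℕ) : ℤ) * t := by
    show ((F.L * Mc : ℕ) : ℤ) * (a.valMinAbs : ℤ) + (((x i).val % (F.L * Mc) : ℕ) : ℤ) = _
    have e1 : (a.valMinAbs : ℤ) = (a.val : ℤ) + (Sect2.domCount (F.P K) Mc (k + 1) : ℤ) * t := by linarith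
    have e2 : ((x i).val : ℤ) = ((F.L * Mc : ℕ) : ℤ) * (((x i).val / (F.L * Mc) : ℕ) : ℤ) + (((x i).val % (F.L * Mc) : ℕ) : ℤ) := by exact_mod_cast hdm.symm
    rw [hN, e1, hval, e2]; ring
  rw [hy, Int.cast_add, Int.cast_mul, Int.cast_natCast, Int.cast_natCast, ZMod.natCast_self, zero_mul, add_zero, ZMod.natCast_zmod_val]

/-- **`π_k (lift b) = b`** on bonds. [cite: Balaban1987RG1, (1.21) p.264 (bookkeeping)] -/
theorem coverBondAt_twinLiftBond {Mc k K : ℕ} (hMc : McGuard F Mc) (hK : recordK₀ F Mc k ≤ K) (b : PBond (F.P K) k) :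
    coverBondAt (F.P K) k (twinLiftBond F Mc k K b) = b := by
  show (⟨coverAt (F.P K) k (twinLiftSite F Mc k K b.src), b.dir⟩ : PBond (F.P K) k) = b
  rw [coverAt_twinLiftSite hMc hK]

/-- **The lift of a non-b₀ fluctuation bond with cube in `X` is a non-central integer bond of `X̂_K(X)`.** [cite: Balaban1987RG1, (2.11) p.267, (1.21) p.264] -/
theorem twinLiftBond_mem_twinBonds {Mc k K : ℕ} (hMc : McGuard F Mc) (hK : recordK₀ F Mc k ≤ K) (X : (recordDomSys F Mc k K).Dom) (s : NonB0Idx F k K)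
    (hs : cubeOfSite F Mc k K (blockOf s.1.1.src) ∈ (X.1 : Finset (TPt (F.P K).d (Sect2.domCount (F.P K) Mc (k + 1))))) :
    twinLiftBond F Mc k K s.1.1 ∈ twinBonds F Mc (intCubes F Mc k K X) := by
  classical
  have hMc0 : 0 < Mc := PortHRecordRowG.mc_pos hMc
  haveI : NeZero (F.L * Mc) := ⟨(Nat.mul_pos (by have := F.hL.2; omega) hMc0).ne'⟩
  have hk : k + 1 ≤ (F.P K).m + (F.P K).K := succ_le_m_add_K_of_recordK₀_le hK
  unfold twinBonds
  refine Finset.mem_filter.2 ⟨Finset.mem_product.2 ⟨Finset.mem_biUnion.2 ⟨_, Finset.mem_image_of_mem _ hs, ?_⟩, Finset.mem_univ _⟩, fun hc => s.2 ?_⟩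
  · rw [mem_blockSites_iff]; exact blockMap_twinLiftSite hMc s.1.1.src
  · rw [← coverBondAt_twinLiftBond hMc hK s.1.1]
    exact coverBondAt_mem_range_centralBond_of_isCentralZ hk hc

/-- A sub-domain of an off-wrap domain is off-wrap. [cite: Balaban1987RG1, (1.21) p.264 (bookkeeping)] -/
theorem not_mem_recordWrapCtr_of_subset {Mc k K : ℕ} {X Y : (recordDomSys F Mc k K).Dom} (hX : X ∉ recordWrapCtr F Mc k K) (hYX : (Y.1 : Finset _) ⊆ X.1) :
    Y ∉ recordWrapCtr F Mc k K := by
  rw [mem_recordWrapCtr_iff] at hX ⊢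
  rintro ⟨c, hc, hseam⟩
  exact hX ⟨c, hYX hc, hseam⟩

/-- **Every non-central integer bond of `X̂_K(X)` IS the lift of a non-b₀ fluctuation bond with cube in `X`** (its cover; off the wrap class). [cite: Balaban1987RG1, (1.21) p.264, (2.11) p.267] -/
theorem exists_twinLift_preimage {Mc k K : ℕ} (hMc : McGuard F Mc) (hK : recordK₀ F Mc k ≤ K) {X : (recordDomSys F Mc k K).Dom} (hX : X ∉ recordWrapCtr F Mc k K)
    {b : (Fin 4 → ℤ) × Fin 4} (hb : b ∈ twinBonds F Mc (intCubes F Mc k K X)) :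
    ∃ t : PBond (F.P K) k, t ∉ Set.range (recordB0 F k K) ∧
      cubeOfSite F Mc k K (blockOf t.src) ∈ (X.1 : Finset (TPt (F.P K).d (Sect2.domCount (F.P K) Mc (k + 1)))) ∧ twinLiftBond F Mc k K t = b := by
  classical
  have hMc0 : 0 < Mc := PortHRecordRowG.mc_pos hMc
  haveI : NeZero Mc := ⟨hMc0.ne'⟩
  haveI : NeZero (F.L * Mc) := ⟨(Nat.mul_pos (by have := F.hL.2; omega) hMc0).ne'⟩
  have hk : k + 1 ≤ (F.P K).m + (F.P K).K := succ_le_m_add_K_of_recordK₀_le hK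
  unfold twinBonds at hb
  obtain ⟨hb1, hbc⟩ := Finset.mem_filter.1 hb
  obtain ⟨hb1, -⟩ := Finset.mem_product.1 hb1
  obtain ⟨a, ha, hba⟩ := Finset.mem_biUnion.1 hb1
  rw [mem_blockSites_iff] at hba
  have hbX : blockMap (F.L * Mc) b.1 ∈ intCubes F Mc k K X := by rw [hba]; exact ha
  obtain ⟨x, hx, hxa⟩ := Finset.mem_image.1 ha
  -- the cube of the cover of `b̂₋` is `x`
  have hcube : cubeOfSite F Mc k K (blockOf (coverAt (F.P K) k b.1)) = x := by
    rw [blockOf_coverAt hk, cubeOfSite_coverAt hMc hK, blockMap_blockMap (P := F.P K)]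
    show proj _ (blockMap (F.L * Mc) b.1) = x
    rw [hba, ← hxa]
    exact proj_valMinAbs x
  refine ⟨coverBondAt (F.P K) k b, fun hr => hbc (isCentralZ_of_coverBondAt_mem_range hMc hK hX hbX hr), by rw [show (coverBondAt (F.P K) k b).src = coverAt (F.P K) k b.1 from rfl, hcube]; exact hx, ?_⟩
  -- the lift of the cover is `b̂` itself: same window, same cover
  have hz : blockMap (F.L * Mc) (twinLiftSite F Mc k K (coverAt (F.P K) k b.1)) ∈ intCubes F Mc k K X := by
    rw [blockMap_twinLiftSite hMc, hcube]; exact Finset.mem_image_of_mem _ hx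
  have heq := coverAt_levelK_inj_of_blockMap_mem hMc hK hX hz hbX (coverAt_twinLiftSite hMc hK _)
  exact Prod.ext heq rfl

/-! ## §2  ★★★ The cover bridge of the power member -/

open scoped Classical in
/-- **Step A — restriction of the torus datum to the pieces and indices inside `X`** (✓`powMemberPiece_transport` along the subtype inclusions; pieces `Y ⊆ X` vanish on indices with cube outside `X`).
[cite: Balaban1987RG1, (1.7) p.261 (bookkeeping)] -/
theorem powMemberPiece_restrict_cube {Mc k K : ℕ} (X : (recordDomSys F Mc k K).Dom)
    (TYK : (recordDomSys F Mc k K).Dom → Sect2.CPair (F.P K) (MatA 2) → FluctIdx F k K → FluctIdx F k K → ℂ) (φ : Sect2.CPair (F.P K) (MatA 2)) (R : ℝ)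
    (hsupp : ∀ Y ψ (s s' : NonB0Idx F k K),
      (cubeOfSite F Mc k K (blockOf s.1.1.src) ∉ (Y.1 : Finset (TPt (F.P K).d (Sect2.domCount (F.P K) Mc (k + 1)))) ∨
        cubeOfSite F Mc k K (blockOf s'.1.1.src) ∉ (Y.1 : Finset (TPt (F.P K).d (Sect2.domCount (F.P K) Mc (k + 1))))) → TYK Y ψ s.1 s'.1 = 0) :
    powMemberPiece (fun Y : (recordDomSys F Mc k K).Dom => (Y.1 : Finset (TPt (F.P K).d (Sect2.domCount (F.P K) Mc (k + 1))))) (fun Y => nonB0Block F k K (TYK Y φ)) R X.1 =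
      powMemberPiece (fun Y : {Y : (recordDomSys F Mc k K).Dom // (Y.1 : Finset (TPt (F.P K).d (Sect2.domCount (F.P K) Mc (k + 1)))) ⊆ X.1} =>
          (Y.1.1 : Finset (TPt (F.P K).d (Sect2.domCount (F.P K) Mc (k + 1)))))
        (fun Y => Matrix.of fun a b : {s : NonB0Idx F k K // cubeOfSite F Mc k K (blockOf s.1.1.src) ∈ (X.1 : Finset (TPt (F.P K).d (Sect2.domCount (F.P K) Mc (k + 1))))} =>
          TYK Y.1 φ a.1.1 b.1.1) R X.1 := by
  have h := powMemberPiece_transport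
    (fun Y : {Y : (recordDomSys F Mc k K).Dom // (Y.1 : Finset (TPt (F.P K).d (Sect2.domCount (F.P K) Mc (k + 1)))) ⊆ X.1} =>
      (Y.1.1 : Finset (TPt (F.P K).d (Sect2.domCount (F.P K) Mc (k + 1)))))
    (fun Y => Matrix.of fun a b : {s : NonB0Idx F k K // cubeOfSite F Mc k K (blockOf s.1.1.src) ∈ (X.1 : Finset (TPt (F.P K).d (Sect2.domCount (F.P K) Mc (k + 1))))} =>
      TYK Y.1 φ a.1.1 b.1.1)
    (fun Y : (recordDomSys F Mc k K).Dom => (Y.1 : Finset (TPt (F.P K).d (Sect2.domCount (F.P K) Mc (k + 1))))) (fun Y => nonB0Block F k K (TYK Y φ))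
    Subtype.val Subtype.val_injective id Function.injective_id Subtype.val Subtype.val_injective
    (fun Y => (Finset.image_id (s := (Y.1.1 : Finset (TPt (F.P K).d (Sect2.domCount (F.P K) Mc (k + 1)))))).symm) X.1
    (fun Y hY hsub => (hY ⟨⟨Y, by rwa [Finset.image_id] at hsub⟩, rfl⟩).elim)
    (fun Y a b => rfl)
    (fun Y a' b' hab => by
      show TYK Y.1 φ a'.1 b'.1 = 0
      refine hsupp Y.1 φ a' b' ?_
      rcases hab with h | h
      · exact Or.inl fun hm => h ⟨⟨a', Y.2 hm⟩, rfl⟩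
      · exact Or.inr fun hm => h ⟨⟨b', Y.2 hm⟩, rfl⟩) R
  rw [Finset.image_id] at h
  exact h

open scoped Classical in
/-- **Step B — the centred lift carries the restricted torus datum to the integer datum of `X̂_K(X)`** (✓`powMemberPiece_transport` along `Y ↦ X̂_K(Y)`, `valMinAbs`, `(b, a) ↦ (b̂, a)`; entries by
(Z-bridge) ∕ (P4-supp) ∕ (Z-supp); non-lifts by (Z-dom)). [cite: Balaban1987RG1, (1.21) p.264, (1.7) p.261; Balaban1985UV3, (63) p.272] -/
theorem powMemberPiece_twinLift {Mc k K : ℕ} (hMc : McGuard F Mc) (hK : recordK₀ F Mc k ≤ K) {X : (recordDomSys F Mc k K).Dom} (hX : X ∉ recordWrapCtr F Mc k K)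
    (TYK : (recordDomSys F Mc k K).Dom → Sect2.CPair (F.P K) (MatA 2) → FluctIdx F k K → FluctIdx F k K → ℂ)
    (TZY : Finset (Fin 4 → ℤ) → IntBondCfg → ((Fin 4 → ℤ) × Fin 4) × Fin 3 → ((Fin 4 → ℤ) × Fin 4) × Fin 3 → ℂ)
    (φ : Sect2.CPair (F.P K) (MatA 2)) (R : ℝ)
    (hZsupp : ∀ (Xh : Finset (Fin 4 → ℤ)) (f : IntBondCfg) (bi bj : (Fin 4 → ℤ) × Fin 4) (a a' : Fin 3),
      (blockMap (F.L * Mc) bi.1 ∉ Xh ∨ blockMap (F.L * Mc) bj.1 ∉ Xh) → TZY Xh f (bi, a) (bj, a') = 0)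
    (hZdom : ∀ (Xh : Finset (Fin 4 → ℤ)) (f : IntBondCfg) (i j : ((Fin 4 → ℤ) × Fin 4) × Fin 3), ¬ (Xh.Nonempty ∧ B13ScaleTransfer.FaceConnected Xh) → TZY Xh f i j = 0)
    (hZbr : ∀ (Y : (recordDomSys F Mc k K).Dom), Y ∉ recordWrapCtr F Mc k K →
      ∀ (ψ : Sect2.CPair (F.P K) (MatA 2)) (bi bj : (Fin 4 → ℤ) × Fin 4) (a a' : Fin 3),
        blockMap (F.L * Mc) bi.1 ∈ intCubes F Mc k K Y → blockMap (F.L * Mc) bj.1 ∈ intCubes F Mc k K Y →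
          TYK Y ψ (coverBondAt (F.P K) k bi, a) (coverBondAt (F.P K) k bj, a') = TZY (intCubes F Mc k K Y) (pullPair F K ψ) (bi, a) (bj, a'))
    (hsupp : ∀ Y ψ (s s' : NonB0Idx F k K),
      (cubeOfSite F Mc k K (blockOf s.1.1.src) ∉ (Y.1 : Finset (TPt (F.P K).d (Sect2.domCount (F.P K) Mc (k + 1)))) ∨
        cubeOfSite F Mc k K (blockOf s'.1.1.src) ∉ (Y.1 : Finset (TPt (F.P K).d (Sect2.domCount (F.P K) Mc (k + 1))))) → TYK Y ψ s.1 s'.1 = 0) :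
    powMemberPiece (fun Yh : ↥(intCubes F Mc k K X).powerset => (Yh.1 : Finset (Fin 4 → ℤ))) (fun Yh => twinMat F Mc TZY (intCubes F Mc k K X) Yh.1 (pullPair F K φ)) R
        ((X.1 : Finset (TPt (F.P K).d (Sect2.domCount (F.P K) Mc (k + 1)))).image (fun c (i : Fin 4) => (c i).valMinAbs)) =
      powMemberPiece (fun Y : {Y : (recordDomSys F Mc k K).Dom // (Y.1 : Finset (TPt (F.P K).d (Sect2.domCount (F.P K) Mc (k + 1)))) ⊆ X.1} =>
          (Y.1.1 : Finset (TPt (F.P K).d (Sect2.domCount (F.P K) Mc (k + 1)))))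
        (fun Y => Matrix.of fun a b : {s : NonB0Idx F k K // cubeOfSite F Mc k K (blockOf s.1.1.src) ∈ (X.1 : Finset (TPt (F.P K).d (Sect2.domCount (F.P K) Mc (k + 1))))} =>
          TYK Y.1 φ a.1.1 b.1.1) R X.1 := by
  have he_inj : Function.Injective (fun (c : TPt (F.P K).d (Sect2.domCount (F.P K) Mc (k + 1))) (i : Fin 4) => (c i).valMinAbs) :=
    valMinAbs_lift_injective (Sect2.domCount (F.P K) Mc (k + 1))
  -- the two embeddings
  have heι : Function.Injective (fun Y : {Y : (recordDomSys F Mc k K).Dom // (Y.1 : Finset (TPt (F.P K).d (Sect2.domCount (F.P K) Mc (k + 1)))) ⊆ X.1} =>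
      (⟨(Y.1.1 : Finset (TPt (F.P K).d (Sect2.domCount (F.P K) Mc (k + 1)))).image (fun c (i : Fin 4) => (c i).valMinAbs),
        Finset.mem_powerset.2 (Finset.image_subset_image Y.2)⟩ : ↥(intCubes F Mc k K X).powerset)) := by
    intro Y Y' h
    have h1 := congrArg Subtype.val h
    exact Subtype.ext (Subtype.ext (Finset.image_injective he_inj h1))
  have heS : Function.Injective (fun s : {s : NonB0Idx F k K // cubeOfSite F Mc k K (blockOf s.1.1.src) ∈ (X.1 : Finset (TPt (F.P K).d (Sect2.domCount (F.P K) Mc (k + 1))))} =>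
      ((s.1.1.2, ⟨twinLiftBond F Mc k K s.1.1.1, twinLiftBond_mem_twinBonds hMc hK X s.1 s.2⟩) : TwinIdx F Mc (intCubes F Mc k K X))) := by
    intro s t h
    have hcol : s.1.1.2 = t.1.1.2 := congrArg Prod.fst h
    have hbond : twinLiftBond F Mc k K s.1.1.1 = twinLiftBond F Mc k K t.1.1.1 := congrArg Subtype.val (congrArg Prod.snd h)
    have hb : s.1.1.1 = t.1.1.1 := by
      rw [← coverBondAt_twinLiftBond hMc hK s.1.1.1, ← coverBondAt_twinLiftBond hMc hK t.1.1.1, hbond]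
    exact Subtype.ext (Subtype.ext (Prod.ext hb hcol))
  -- the index lift is onto
  have hsurj : ∀ i : TwinIdx F Mc (intCubes F Mc k K X), ∃ s : {s : NonB0Idx F k K // cubeOfSite F Mc k K (blockOf s.1.1.src) ∈ (X.1 : Finset (TPt (F.P K).d (Sect2.domCount (F.P K) Mc (k + 1))))},
      ((s.1.1.2, ⟨twinLiftBond F Mc k K s.1.1.1, twinLiftBond_mem_twinBonds hMc hK X s.1 s.2⟩) : TwinIdx F Mc (intCubes F Mc k K X)) = i := by
    rintro ⟨a, ⟨b, hb⟩⟩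
    obtain ⟨t, ht, htX, htb⟩ := exists_twinLift_preimage hMc hK hX hb
    exact ⟨⟨⟨(t, a), ht⟩, htX⟩, Prod.ext rfl (Subtype.ext htb)⟩
  refine powMemberPiece_transport
    (fun Y : {Y : (recordDomSys F Mc k K).Dom // (Y.1 : Finset (TPt (F.P K).d (Sect2.domCount (F.P K) Mc (k + 1)))) ⊆ X.1} =>
      (Y.1.1 : Finset (TPt (F.P K).d (Sect2.domCount (F.P K) Mc (k + 1)))))
    (fun Y => Matrix.of fun a b : {s : NonB0Idx F k K // cubeOfSite F Mc k K (blockOf s.1.1.src) ∈ (X.1 : Finset (TPt (F.P K).d (Sect2.domCount (F.P K) Mc (k + 1))))} =>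
      TYK Y.1 φ a.1.1 b.1.1)
    (fun Yh : ↥(intCubes F Mc k K X).powerset => (Yh.1 : Finset (Fin 4 → ℤ))) (fun Yh => twinMat F Mc TZY (intCubes F Mc k K X) Yh.1 (pullPair F K φ))
    _ heι (fun c (i : Fin 4) => (c i).valMinAbs) he_inj _ heS (fun Y => rfl) X.1 ?_ ?_ ?_ R
  · -- integer cube sets that are not lifts carry the zero piece ((Z-dom))
    intro Yh hYh _
    exact twinMat_eq_zero_of_not_lift X hZdom (Finset.mem_powerset.1 Yh.2) (fun Y hYX heq => hYh ⟨⟨Y, hYX⟩, Subtype.ext heq⟩) _ _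
  · -- entries on the image: (Z-bridge) on the cubes of `Y`, zero off them
    intro Y a b
    have hYw : Y.1 ∉ recordWrapCtr F Mc k K := not_mem_recordWrapCtr_of_subset hX Y.2
    show TZY ((Y.1.1 : Finset _).image (fun c (i : Fin 4) => (c i).valMinAbs)) (pullPair F K φ) (twinLiftBond F Mc k K a.1.1.1, a.1.1.2) (twinLiftBond F Mc k K b.1.1.1, b.1.1.2) =
      TYK Y.1 φ a.1.1 b.1.1
    by_cases hab : cubeOfSite F Mc k K (blockOf a.1.1.1.src) ∈ (Y.1.1 : Finset _) ∧ cubeOfSite F Mc k K (blockOf b.1.1.1.src) ∈ (Y.1.1 : Finset _)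
    · have ha : blockMap (F.L * Mc) (twinLiftBond F Mc k K a.1.1.1).1 ∈ intCubes F Mc k K Y.1 := by
        show blockMap (F.L * Mc) (twinLiftSite F Mc k K a.1.1.1.src) ∈ _
        rw [blockMap_twinLiftSite hMc]; exact Finset.mem_image_of_mem _ hab.1
      have hb : blockMap (F.L * Mc) (twinLiftBond F Mc k K b.1.1.1).1 ∈ intCubes F Mc k K Y.1 := by
        show blockMap (F.L * Mc) (twinLiftSite F Mc k K b.1.1.1.src) ∈ _
        rw [blockMap_twinLiftSite hMc]; exact Finset.mem_image_of_mem _ hab.2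
      have h := hZbr Y.1 hYw φ _ _ a.1.1.2 b.1.1.2 ha hb
      rw [coverBondAt_twinLiftBond hMc hK, coverBondAt_twinLiftBond hMc hK] at h
      exact h.symm
    · have hzero : TYK Y.1 φ a.1.1 b.1.1 = 0 := hsupp Y.1 φ a.1 b.1 (not_and_or.1 hab)
      rw [hzero]
      refine hZsupp _ _ _ _ _ _ ?_
      rcases not_and_or.1 hab with h | h
      · left
        show blockMap (F.L * Mc) (twinLiftSite F Mc k K a.1.1.1.src) ∉ _
        rw [blockMap_twinLiftSite hMc]
        exact fun hm => h (by obtain ⟨c, hc, hce⟩ := Finset.mem_image.1 hm; exact he_inj hce ▸ hc)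
      · right
        show blockMap (F.L * Mc) (twinLiftSite F Mc k K b.1.1.1.src) ∉ _
        rw [blockMap_twinLiftSite hMc]
        exact fun hm => h (by obtain ⟨c, hc, hce⟩ := Finset.mem_image.1 hm; exact he_inj hce ▸ hc)
  · -- off the image: nothing, the index lift is onto
    intro Y a' b' hab
    rcases hab with h | h
    · exact (h (hsurj a')).elim
    · exact (h (hsurj b')).elim

open scoped Classical in
/-- ★★★ **THE COVER BRIDGE OF THE (63) POWER MEMBER**: off the centred wrap class, the integer power-member formula at `X̂_K(X)` and the pulled-back pair IS the torus power piece of `X`: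
`powTwin F Mc TZY R (X̂_K(X)) (φ ∘ π) = powMemberPiece (Y ↦ Y) (Y ↦ nonB0Block (TY Y φ)) R X` (Step B ∘ Step A). [cite: Balaban1987RG1, (1.21) p.264, (1.7) p.261; Balaban1985UV3, (63) p.272] -/
theorem powTwin_intCubes_pullPair {Mc k K : ℕ} (hMc : McGuard F Mc) (hK : recordK₀ F Mc k ≤ K) {X : (recordDomSys F Mc k K).Dom} (hX : X ∉ recordWrapCtr F Mc k K)
    (TYK : (recordDomSys F Mc k K).Dom → Sect2.CPair (F.P K) (MatA 2) → FluctIdx F k K → FluctIdx F k K → ℂ)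
    (TZY : Finset (Fin 4 → ℤ) → IntBondCfg → ((Fin 4 → ℤ) × Fin 4) × Fin 3 → ((Fin 4 → ℤ) × Fin 4) × Fin 3 → ℂ)
    (φ : Sect2.CPair (F.P K) (MatA 2)) (R : ℝ)
    (hZsupp : ∀ (Xh : Finset (Fin 4 → ℤ)) (f : IntBondCfg) (bi bj : (Fin 4 → ℤ) × Fin 4) (a a' : Fin 3),
      (blockMap (F.L * Mc) bi.1 ∉ Xh ∨ blockMap (F.L * Mc) bj.1 ∉ Xh) → TZY Xh f (bi, a) (bj, a') = 0)
    (hZdom : ∀ (Xh : Finset (Fin 4 → ℤ)) (f : IntBondCfg) (i j : ((Fin 4 → ℤ) × Fin 4) × Fin 3), ¬ (Xh.Nonempty ∧ B13ScaleTransfer.FaceConnected Xh) → TZY Xh f i j = 0)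
    (hZbr : ∀ (Y : (recordDomSys F Mc k K).Dom), Y ∉ recordWrapCtr F Mc k K →
      ∀ (ψ : Sect2.CPair (F.P K) (MatA 2)) (bi bj : (Fin 4 → ℤ) × Fin 4) (a a' : Fin 3),
        blockMap (F.L * Mc) bi.1 ∈ intCubes F Mc k K Y → blockMap (F.L * Mc) bj.1 ∈ intCubes F Mc k K Y →
          TYK Y ψ (coverBondAt (F.P K) k bi, a) (coverBondAt (F.P K) k bj, a') = TZY (intCubes F Mc k K Y) (pullPair F K ψ) (bi, a) (bj, a'))
    (hsupp : ∀ Y ψ (s s' : NonB0Idx F k K),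
      (cubeOfSite F Mc k K (blockOf s.1.1.src) ∉ (Y.1 : Finset (TPt (F.P K).d (Sect2.domCount (F.P K) Mc (k + 1)))) ∨
        cubeOfSite F Mc k K (blockOf s'.1.1.src) ∉ (Y.1 : Finset (TPt (F.P K).d (Sect2.domCount (F.P K) Mc (k + 1))))) → TYK Y ψ s.1 s'.1 = 0) :
    powTwin F Mc TZY R (intCubes F Mc k K X) (pullPair F K φ) =
      powMemberPiece (fun Y : (recordDomSys F Mc k K).Dom => (Y.1 : Finset (TPt (F.P K).d (Sect2.domCount (F.P K) Mc (k + 1)))))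
        (fun Y => nonB0Block F k K (TYK Y φ)) R X.1 :=
  (powMemberPiece_twinLift hMc hK hX TYK TZY φ R hZsupp hZdom hZbr hsupp).trans (powMemberPiece_restrict_cube X TYK φ R hsupp).symm

/-! ## §3  ★★★ `PowMemberIntTwin F` -/

/-- ★★★ **THE INTEGER TWIN OF THE (63) POWER MEMBER EXISTS**: `PowMemberIntTwin F` — witness `powTwinLocal F Mc k TZY AdZ R` ((Z-loc), (Z-cov)), its pieces = the torus power pieces off the wrap class
at every volume `recordK₀ + n` (§2 with (Z-supp), (Z-dom), (Z-bridge), (P4-supp)). [cite: Balaban1987RG1, (1.21) p.264, (1.7) p.261, (1.19) p.263; Balaban1985UV3, (63) p.272] -/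
theorem powMemberIntTwin_holds (F : T4Family) : PowMemberIntTwin F := by
  intro Mc hMc a₀ δ₀ c₀ γ₀ γ₁ α₀ α₁ ε₂₉ k TC TY TZY AdM AdZ hP R
  obtain ⟨hZsupp, hZdom, hZloc, hZcov, hZbr, -, -, -, hP4supp, -⟩ := hP
  refine ⟨powTwinLocal F Mc k TZY AdZ R hZloc hZcov, fun n X hX φ => ?_⟩
  have hK : recordK₀ F Mc k ≤ recordK₀ F Mc k + n := Nat.le_add_right _ _
  exact powTwin_intCubes_pullPair hMc hK hX (TY n) TZY φ R hZsupp hZdom (fun Y hY ψ bi bj a a' hi hj => hZbr n Y hY ψ bi bj a a' hi hj)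
    (fun Y ψ s s' h => fluct_supp_of_cube hMc hK (hP4supp n) Y ψ s s' h)

end Summit.QuantumFields.YangMills.Theorems.BalabanUVNodesPortS1

end
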